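import Summits.FinalStateConjecture.FinalStateConjecture.Theorems.ZeroEnergyKerrOrBombErgoregionBombModTEscapeEngine
import Summits.FinalStateConjecture.FinalStateConjecture.Theorems.ZeroEnergyKerrOrBombErgoregionBombModTCertificateTransport
import Summits.FinalStateConjecture.FinalStateConjecture.Theorems.ZeroEnergyKerrOrBombErgoregionBombModTCertificateCompactness
import Summits.FinalStateConjecture.FinalStateConjecture.Theorems.ZeroEnergyKerrOrBombErgoregionBombModTLogDivergenceAtFiniteEnd
import Summits.FinalStateConjecture.FinalStateConjecture.Theorems.ZeroEnergyKerrOrBombErgoregionBombModTHessianSublevelCompact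

/-!
# The X-free zero-energy escape ENGINE and `ErgoregionBombModT ⇐ ZF₀`
# (crux stmt-FinalStateConjecture-17838, line `SketchIdeator4` v4, stub `stub_escapeEngineFree`)

Route `ZeroEnergyKerrOrBomb` of the Final State Conjecture, crux `ErgoregionBombModT` (the ergoregion bomb modulo the
stationary flow), line `SketchIdeator4` (crux idea card `Cruxes/ErgoregionBombModT/Ideas/zero-energy-escape.md`).
Lead a1's engine `stub_escapeEngine` (p156340) closes the crux by VACUITY of its antecedent from a zero-energy escape
certificate `(W, F, τ, c, C)` on every cage, where `τ` is a Killing time WITH SPACELIKE LEVEL SETS — on a general vacuum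
`I⁺`-regular d.o.c. a cited theorem (Chruściel–Costa 2008, Thm. 4.5; the Literature named fact
`chruscielCosta2008_spacelikeTimeFunction`, p160663), so that c6's assembly `ergoregionBombModT_of_nullConvex` (p160463) is
CONDITIONAL on it.  This file removes the time function altogether:

**Theorem (`stub_escapeEngineFree`, the registered stub ENG″ of skeleton v4).**  Let `𝓑` be a stationary asymptotically
flat black hole with stationary Killing field `T` and flow `φₜ`, `S` compact, `W ⊇ ⋃ₜ φₜ(S)` open, `F ∈ C²(W)` invariant
along the integral curves of `T` issued from `W`, and `Hess F_x(k, k) > 0` for every `x ∈ S` and every non-zero zero-energy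
null vector `k` (`g(k,k) = 0`, `g(k,T) = 0`).  Then no maximal null geodesic `γ` (domain `s ≠ ∅`) with `γ̇ ≠ 0`, `g(γ̇, T) = 0`
is confined to `⋃ₜ φₜ(S)`.

Proof — *the escape function is its own yardstick*.  Fix `t ∈ s`, write `γ t = φᵣ y` with `y ∈ S` and transport the
velocity by the flow isometry, `k̃ := dφ₋ᵣ γ̇(t) ∈ T_y M`: it is null, zero-energy (`dφ₋ᵣ T = T ∘ φ₋ᵣ`,
`mfderiv_flow_apply_self`) and non-zero, and `Hess F_{γ t}(γ̇, γ̇) = Hess F_y(k̃, k̃) =: w(t) > 0` (isometries preserve the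
Hessian, `hessian_comp_of_isometry` of U1 p159576, and `F ∘ φ₋ᵣ = F` near `γ t`).  The zero-energy null vectors over `S`
with `Hess F ≤ 1` lie in a compact `𝒦 ⊆ TM` (brick N1 `stub_hessianSublevelCompact`), on which geodesics have a uniform
existence time `ε` (`exists_uniform_isGeodesicOn_of_isCompact`, Lee 2018 Lemma 6.19).  With `λ := √w(t)`, the datum
`(y, λ⁻¹ k̃)` lies in `𝒦`; the affine rescaling by `λ` of its local geodesic (`IsGeodesicOn.comp_affine_holds`, O'Neill 1983
Ch. 3 Lemma 26), transported back by `φᵣ` (`IsIsometricImmersion.isGeodesicOn_comp`), is a geodesic through `(γ t, γ̇ t)`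
on `(−ε/λ, ε/λ)`, which maximality puts inside `s` (`isMaximalGeodesicOn_add_mem_of_isGeodesicOn`, O'Neill Ch. 3
Prop. 24).  Hence the QUANTITATIVE ESCAPE LAW
`Hess F(γ̇ t, γ̇ t) ≥ ε² / (sup s − t)²` if `s` is bounded above, `≥ ε² / (t − inf s)²` if bounded below.
Now `φ := F ∘ γ` is bounded (invariance of `F`, compactness of `S`) with `φ' = dF(γ̇)`, `φ'' = Hess F(γ̇, γ̇)` (G12
p154804): a finite end is impossible by the log-divergence of `∫∫ ε²/(b − t)²` (brick N3 `stub_logDivergenceAtFiniteEnd`,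
from R23 p154806), and two infinite ends by strict convexity of a bounded function on `ℝ` (R1 p154600).  No time function,
no causality theory, no `I⁺`-regularity, no field equations are used.

**Corollary (`ergoregionBombModT_of_nullConvexFunction`).**  `ErgoregionBombModT ⇐ ZF₀` UNCONDITIONALLY: hypothesis =
the registered open stub `stub_zeroEnergyNullConvexFunction` verbatim, conclusion = the body of the route decl verbatim (so
the type δ-unfolds to `Theses.ZeroEnergyKerrOrBomb.ErgoregionBombModT` and the file stays free of the `Theses` import).
It supersedes the conditional `ergoregionBombModT_of_nullConvex` (p160463): the named fact X is idle.  ZF₀ itself — the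
pointwise zero-energy escape function, certificate half of the Alexakis–Ionescu–Klainerman picture, Kerr-true by Carter's
sign `Kerr.hessAt_radius_neg_of_ksEnergy_eq_zero` — is open in general and is NOT claimed here.

References: B. O'Neill, *Semi-Riemannian geometry* (1983), Ch. 3, Lemma 26, Prop. 24, Prop. 3.59; Ch. 5, Lemma 8;
J. M. Lee, *Introduction to Riemannian Manifolds* (2018), Lemma 6.19; G. P. Paternain, M. Salo, G. Uhlmann, *Geometric
inverse problems* (2023), Prop. 3.3.1 (escape functions); crux workfiles `Cruxes/ErgoregionBombModT/Lines/SketchIdeator4.lean`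
(v4), `Cruxes/ErgoregionBombModT/PICKED.md` (lead c7).
-/

noncomputable section

open Bundle Set Filter Function
open scoped Manifold Topology

set_option linter.dupNamespace false

namespace Summit.FinalStateConjecture.FinalStateConjecture.Theorems.ErgoregionBombModT

open Literature.Geometry.Lorentzian

/-! ### Real-variable glue -/

/-- If every `u` with `|u| < η` has `u + t ∈ s` and `s` is bounded above, then `η ≤ sup s − t`. [folklore] -/
private theorem le_csSup_sub_of_forall_add_mem {s : Set ℝ} (hab : BddAbove s) {t η : ℝ} (hη : 0 < η)
    (h : ∀ u ∈ Ioo (-η) η, u + t ∈ s) : η ≤ sSup s - t := by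
  by_contra hcon
  push Not at hcon
  -- `t ≤ sup s` (take `u = 0`), so some `u ∈ (sup s − t, η)` is admissible and overshoots the supremum
  have ht : t ≤ sSup s := by
    have := le_csSup hab (h 0 ⟨neg_lt_zero.2 hη, hη⟩)
    simpa using this
  obtain ⟨u, hu1, hu2⟩ := exists_between hcon
  have hu0 : -η < u := by linarith
  have hmem := h u ⟨hu0, hu2⟩
  have := le_csSup hab hmem
  linarith

/-- If every `u` with `|u| < η` has `u + t ∈ s` and `s` is bounded below, then `η ≤ t − inf s`. [folklore] -/
private theorem le_sub_csInf_of_forall_add_mem {s : Set ℝ} (hbb : BddBelow s) {t η : ℝ} (hη : 0 < η)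
    (h : ∀ u ∈ Ioo (-η) η, u + t ∈ s) : η ≤ t - sInf s := by
  by_contra hcon
  push Not at hcon
  have ht : sInf s ≤ t := by
    have := csInf_le hbb (h 0 ⟨neg_lt_zero.2 hη, hη⟩)
    simpa using this
  obtain ⟨u, hu1, hu2⟩ := exists_between hcon
  -- `t - inf s < u < η`; use `-u`
  have hu0 : -η < -u := by linarith
  have huη : -u < η := by linarith
  have hmem := h (-u) ⟨hu0, huη⟩
  have := csInf_le hbb hmem
  linarith

/-- From `η ≤ d`, `0 < η = ε / l`, `l > 0`: `ε² / d² ≤ l²`. [folklore] -/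
private theorem sq_div_sq_le_of_div_le {ε l d : ℝ} (hε : 0 < ε) (hl : 0 < l) (h : ε / l ≤ d) :
    ε ^ 2 / d ^ 2 ≤ l ^ 2 := by
  have hd : 0 < d := lt_of_lt_of_le (div_pos hε hl) h
  have h1 : ε ≤ l * d := by rwa [div_le_iff₀' hl] at h
  have h2 : ε ^ 2 ≤ (l * d) ^ 2 := pow_le_pow_left₀ hε.le h1 2
  rw [div_le_iff₀ (by positivity)]
  calc ε ^ 2 ≤ (l * d) ^ 2 := h2
    _ = l ^ 2 * d ^ 2 := by ring

/-! ### The X-free engine -/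

/-- **ENG″ — the X-free zero-energy escape engine** (registered stub `stub_escapeEngineFree` of line `SketchIdeator4`, v4):
on a stationary asymptotically flat black hole, if the cage `⋃ₜ φₜ(S)` of a compact `S` lies in an open `W` carrying
`F ∈ C²(W)`, invariant along the integral curves of `T` issued from `W` and with `Hess F_x(k,k) > 0` for `x ∈ S` and every
non-zero zero-energy null `k`, then no maximal null geodesic with `γ̇ ≠ 0`, `g(γ̇, T) = 0` on its non-empty domain is confined
to the cage.  Proof: flow transport of the tangent lift to `S`, compactness of the `Hess F`-sublevel zero-energy null vectors
over `S` (N1), uniform existence time, affine rescaling by `√Hess F(γ̇,γ̇)` and maximality give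
`Hess F(γ̇ t, γ̇ t) ≥ ε²/dist(t, ∂s)²`; then N3 at a finite end and R1 on `ℝ` contradict the boundedness of `F ∘ γ`
(see the module docstring). -/
theorem stub_escapeEngineFree : ∀ (𝓑 : Literature.Geometry.Lorentzian.StationaryAFBlackHole.{0}) [𝓑.metric.HasLeviCivita] (S W : Set 𝓑.carrier) (F : 𝓑.carrier → ℝ), IsCompact S → IsOpen W → Literature.Geometry.Lorentzian.stationaryOrbit 𝓑.killing S ⊆ W → ContMDiffOn (𝓡 4) 𝓘(ℝ, ℝ) 2 F W → (∀ σ : ℝ → 𝓑.carrier, IsMIntegralCurve σ 𝓑.killing → σ 0 ∈ W → ∀ t, F (σ t) = F (σ 0)) → (∀ x ∈ S, ∀ k : TangentSpace (𝓡 4) x, 𝓑.metric.val x k k = 0 → 𝓑.metric.val x k (𝓑.killing x) = 0 → k ≠ 0 → 0 < 𝓑.metric.toPseudoRiemannianMetric.hessian F x k k) → ∀ (γ : ℝ → 𝓑.carrier) (s : Set ℝ), Literature.Geometry.Lorentzian.IsMaximalGeodesicOn 𝓑.metric.toPseudoRiemannianMetric.leviCivita γ s → s.Nonempty → (∀ t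 ∈ s, 𝓑.metric.val (γ t) (Literature.Geometry.Lorentzian.velocity (𝓡 4) γ t) (Literature.Geometry.Lorentzian.velocity (𝓡 4) γ t) = 0 ∧ Literature.Geometry.Lorentzian.velocity (𝓡 4) γ t ≠ 0 ∧ 𝓑.metric.val (γ t) (Literature.Geometry.Lorentzian.velocity (𝓡 4) γ t) (𝓑.killing (γ t)) = 0) → (∀ t ∈ s, γ t ∈ Literature.Geometry.Lorentzian.stationaryOrbit 𝓑.killing S) → False := by
  intro 𝓑 _ S W F hS hW hSW hF hinv hpos γ s hγ hs hz hin
  -- instances: the Levi-Civita connection of the smooth metric is `C¹`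
  haveI : Fact ((1 : WithTop ℕ∞) ≤ ((⊤ : ℕ∞) : WithTop ℕ∞)) := ⟨by exact_mod_cast le_top⟩
  haveI : CovariantDerivative.ContMDiffCovariantDerivative 𝓑.metric.leviCivita 1 :=
    ⟨𝓑.metric.toPseudoRiemannianMetric.isLocallyContMDiff_leviCivita_holds 1
      (by rw [show ((1 : ℕ∞) : WithTop ℕ∞) + 1 = 2 by norm_num]; exact WithTop.coe_le_coe.2 le_top)
      univ isOpen_univ⟩
  -- the stationary flow
  obtain ⟨θ, hθ, hθ0, hθadd, hθX, hiso, -⟩ := 𝓑.exists_stationary_flow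
  have hθ2 : ContMDiff (𝓘(ℝ, ℝ).prod (𝓡 4)) (𝓡 4) 2 θ := hθ.of_le (WithTop.coe_le_coe.mpr le_top)
  have hK : 𝓑.metric.IsKillingField 𝓑.killing := 𝓑.isStationaryKilling.isKillingField
  have hK1 : ContMDiff (𝓡 4) (𝓡 4).tangent 1
      (fun x ↦ (⟨x, 𝓑.killing x⟩ : TangentBundle (𝓡 4) 𝓑.carrier)) :=
    hK.contMDiff.of_le (WithTop.coe_le_coe.mpr le_top)
  -- the flow maps are smooth isometric immersions with injective differentials
  have hφs : ∀ r : ℝ, ContMDiff (𝓡 4) (𝓡 4) ((⊤ : ℕ∞) : WithTop ℕ∞) (fun q ↦ θ (r, q)) := fun r ↦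
    hθ.comp (contMDiff_const.prodMk contMDiff_id)
  have hφi : ∀ r : ℝ, PseudoRiemannianMetric.IsIsometricImmersion 𝓑.metric.toPseudoRiemannianMetric
      𝓑.metric.toPseudoRiemannianMetric (fun q ↦ θ (r, q)) := fun r ↦
    ⟨hφs r, fun y ↦ by
      ext v w
      rw [pullbackBilin_apply]
      exact hiso r y v w⟩
  have hφinj : ∀ (r : ℝ) (y : 𝓑.carrier),
      Function.Injective (mfderiv (𝓡 4) (𝓡 4) (fun q ↦ θ (r, q)) y) := fun r y ↦
    Function.LeftInverse.injective
      (g := mfderiv (𝓡 4) (𝓡 4) (fun q ↦ θ (-r, q)) (θ (r, y)))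
      (PseudoRiemannianMetric.mfderiv_flow_neg_apply_mfderiv_flow hθ2 hθ0 hθadd r y)
  -- bookkeeping
  have hSW' : S ⊆ W :=
    (subset_stationaryOrbit 𝓑.isStationaryKilling.isCompleteVectorField S).trans hSW
  have hγW : ∀ t ∈ s, γ t ∈ W := fun t ht ↦ hSW (hin t ht)
  have hso : IsOpen s := hγ.1
  have hsc : s.OrdConnected := hγ.2.1
  have hgeo : IsGeodesicOn 𝓑.metric.toPseudoRiemannianMetric.leviCivita γ s := hγ.2.2.1
  obtain ⟨t₀, ht₀⟩ := hs
  -- calculus along `γ` (G12)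
  obtain ⟨hderF, hbddF⟩ := stub_calculusAlongGeodesic 𝓑 W F hW hF
  set φ : ℝ → ℝ := fun t ↦ F (γ t) with hφ
  set u : ℝ → ℝ := fun t ↦ mvfderiv (𝓡 4) F (γ t) (velocity (𝓡 4) γ t) with hu
  set w : ℝ → ℝ := fun t ↦
    𝓑.metric.toPseudoRiemannianMetric.hessian F (γ t) (velocity (𝓡 4) γ t) (velocity (𝓡 4) γ t) with hw
  have hφ' : ∀ t ∈ s, HasDerivAt φ (u t) t := fun t ht ↦ (hderF γ s hgeo hγW t ht).1
  have hu' : ∀ t ∈ s, HasDerivAt u (w t) t := fun t ht ↦ (hderF γ s hgeo hγW t ht).2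
  -- boundedness of `φ` (invariance of `F` along the flow lines from `S`)
  obtain ⟨M, hM⟩ := hbddF S hS hSW' (fun σ hσ h0 t ↦ hinv σ hσ (hSW' h0) t)
  have hMφ : ∀ t ∈ s, |φ t| ≤ M := fun t ht ↦ hM (γ t) (hin t ht)
  -- the compact set of `Hess F`-sublevel zero-energy null vectors over `S` (N1) and its uniform time
  obtain ⟨𝒦, h𝒦, hmem⟩ := stub_hessianSublevelCompact 𝓑 S W F hS hW hSW' hF hpos
  obtain ⟨ε, hε, huni⟩ :=
    exists_uniform_isGeodesicOn_of_isCompact (cov := 𝓑.metric.toPseudoRiemannianMetric.leviCivita) h𝒦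
  -- KEY: positivity of `w` and the rescaled local geodesic at every parameter of `s`
  have key : ∀ t ∈ s, 0 < w t ∧
      ∀ u ∈ Ioo (-(ε / Real.sqrt (w t))) (ε / Real.sqrt (w t)), u + t ∈ s := by
    intro t ht
    obtain ⟨σ, hσ, hσ0, r, hr⟩ := hin t ht
    -- `γ t = φᵣ (σ 0)` and `φ₋ᵣ (γ t) = σ 0 ∈ S`
    have hflow : γ t = θ (r, σ 0) := by rw [← hr]; exact eq_flow_of_isMIntegralCurve hK1 hθX hθ0 hσ r
    have hback : θ (-r, γ t) = σ 0 := by rw [hflow]; exact flow_neg_apply_flow hθ0 hθadd r (σ 0)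
    have hyS : θ (-r, γ t) ∈ S := by rw [hback]; exact hσ0
    -- the transported tangent vector
    set v : TangentSpace (𝓡 4) (γ t) := velocity (𝓡 4) γ t with hv
    set k : TangentSpace (𝓡 4) (θ (-r, γ t)) := mfderiv (𝓡 4) (𝓡 4) (fun q ↦ θ (-r, q)) (γ t) v
      with hk
    have hknull : 𝓑.metric.val (θ (-r, γ t)) k k = 0 := by
      rw [hk, hiso (-r) (γ t) v v]
      exact (hz t ht).1
    have hkT : 𝓑.metric.val (θ (-r, γ t)) k (𝓑.killing (θ (-r, γ t))) = 0 := by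
      rw [hk, ← mfderiv_flow_apply_self hθ2 hθ0 hθadd hθX (-r) (γ t), hiso (-r) (γ t)]
      exact (hz t ht).2.2
    have hkv : mfderiv (𝓡 4) (𝓡 4) (fun q ↦ θ (r, q)) (θ (-r, γ t)) k = v := by
      have h3 := PseudoRiemannianMetric.mfderiv_flow_neg_apply_mfderiv_flow hθ2 hθ0 hθadd (-r) (γ t) v
      rw [neg_neg] at h3
      exact h3
    have hk0 : k ≠ 0 := by
      intro h0
      apply (hz t ht).2.1
      show v = 0
      rw [← hkv, h0]
      exact map_zero _
    -- transport of the Hessian: `w t = Hess F_{φ₋ᵣ(γ t)} (k, k)`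
    have hF2 : ContMDiffAt (𝓡 4) 𝓘(ℝ, ℝ) 2 F (θ (-r, γ t)) :=
      hF.contMDiffAt (hW.mem_nhds (hSW' hyS))
    have hFev : (F ∘ fun q ↦ θ (-r, q)) =ᶠ[𝓝 (γ t)] F := by
      filter_upwards [hW.mem_nhds (hγW t ht)] with x hx
      have h := hinv (fun s' ↦ θ (s', x)) (hθX x) (by simpa [hθ0] using hx) (-r)
      simpa [hθ0] using h
    have hΦ : ContMDiff (𝓡 4) (𝓡 4) (((⊤ : ℕ∞) : WithTop ℕ∞) + 1) (fun q ↦ θ (-r, q)) := by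
      have h1 : ContMDiff (𝓡 4) (𝓡 4) ((⊤ : ℕ∞) : WithTop ℕ∞) (fun q ↦ θ (-r, q)) := hφs (-r)
      exact h1.of_le le_rfl
    have hHess : w t = 𝓑.metric.toPseudoRiemannianMetric.hessian F (θ (-r, γ t)) k k := by
      have h1 := hessian_comp_of_isometry (g := 𝓑.metric.toPseudoRiemannianMetric)
        hΦ (hφinj (-r)) (hiso (-r)) hF2 v v
      rw [𝓑.metric.toPseudoRiemannianMetric.hessian_congr_of_eventuallyEq hFev] at h1
      exact h1
    have hwpos : 0 < w t := by
      rw [hHess]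
      exact hpos _ hyS k hknull hkT hk0
    refine ⟨hwpos, fun u' hu' ↦ ?_⟩
    -- the rescaled transported vector lies in `𝒦`
    set l : ℝ := Real.sqrt (w t) with hl_def
    have hl : 0 < l := Real.sqrt_pos.2 hwpos
    have hl2 : l ^ 2 = w t := Real.sq_sqrt hwpos.le
    set p : TangentBundle (𝓡 4) 𝓑.carrier := ⟨θ (-r, γ t), l⁻¹ • k⟩ with hp
    have hp𝒦 : p ∈ 𝒦 := by
      refine hmem p hyS ?_ ?_ ?_
      · show 𝓑.metric.val (θ (-r, γ t)) (l⁻¹ • k) (l⁻¹ • k) = 0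
        simp [hknull]
      · show 𝓑.metric.val (θ (-r, γ t)) (l⁻¹ • k) (𝓑.killing (θ (-r, γ t))) = 0
        simp [hkT]
      · show 𝓑.metric.toPseudoRiemannianMetric.hessian F (θ (-r, γ t)) (l⁻¹ • k) (l⁻¹ • k) ≤ 1
        have h1 : 𝓑.metric.toPseudoRiemannianMetric.hessian F (θ (-r, γ t)) (l⁻¹ • k) (l⁻¹ • k) =
            l⁻¹ * (l⁻¹ * 𝓑.metric.toPseudoRiemannianMetric.hessian F (θ (-r, γ t)) k k) := by
          simp only [map_smul, LinearMap.smul_apply, smul_eq_mul]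
        rw [h1, ← hHess, ← hl2]
        have hl0 : l ≠ 0 := hl.ne'
        have h2 : l⁻¹ * (l⁻¹ * l ^ 2) = 1 := by field_simp
        rw [h2]
    -- the local geodesic through `p`, rescaled by `l` and transported back by `φᵣ`
    obtain ⟨β, hβ, hβ0⟩ := huni p hp𝒦
    have hpre : Ioo (-(ε / l)) (ε / l) ⊆ (fun u ↦ l * u + 0) ⁻¹' Ioo (-ε) ε := by
      intro x hx
      have h1 : -ε / l < x := by rw [neg_div]; exact hx.1
      have h2 : -ε < x * l := (div_lt_iff₀ hl).1 h1
      have h3 : x * l < ε := (lt_div_iff₀ hl).1 hx.2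
      show l * x + 0 ∈ Ioo (-ε) ε
      rw [add_zero, mul_comm]
      exact ⟨h2, h3⟩
    have hβl : IsGeodesicOn 𝓑.metric.toPseudoRiemannianMetric.leviCivita (fun u ↦ β (l * u + 0))
        (Ioo (-(ε / l)) (ε / l)) :=
      (IsGeodesicOn.comp_affine_holds hβ l 0).mono hpre
    have hβl0 : tangentLift (𝓡 4) (fun u ↦ β (l * u + 0)) 0 =
        (⟨θ (-r, γ t), k⟩ : TangentBundle (𝓡 4) 𝓑.carrier) := by
      have e1 : tangentLift (𝓡 4) (fun u ↦ β (l * u + 0)) 0 =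
          (fun q : TangentBundle (𝓡 4) 𝓑.carrier ↦
            (TotalSpace.mk' E4 q.proj (l • q.2) : TangentBundle (𝓡 4) 𝓑.carrier))
            (tangentLift (𝓡 4) β (l * 0 + 0)) :=
        tangentLift_comp_affine β l 0 0
      rw [e1, show l * 0 + 0 = (0 : ℝ) by ring, hβ0]
      show (TotalSpace.mk' E4 (θ (-r, γ t)) (l • (l⁻¹ • k)) : TangentBundle (𝓡 4) 𝓑.carrier) = _
      rw [smul_smul, mul_inv_cancel₀ hl.ne', one_smul]
    obtain ⟨hβ', hvel⟩ := (hφi r).isGeodesicOn_comp rfl isOpen_Ioo hβl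
    have h00 : (0 : ℝ) ∈ Ioo (-(ε / l)) (ε / l) := ⟨neg_lt_zero.2 (div_pos hε hl), div_pos hε hl⟩
    have hlift : tangentLift (𝓡 4) ((fun q ↦ θ (r, q)) ∘ fun u ↦ β (l * u + 0)) 0 =
        tangentLift (𝓡 4) γ t := by
      have h1 : tangentLift (𝓡 4) ((fun q ↦ θ (r, q)) ∘ fun u ↦ β (l * u + 0)) 0 =
          tangentMap (𝓡 4) (𝓡 4) (fun q ↦ θ (r, q)) (tangentLift (𝓡 4) (fun u ↦ β (l * u + 0)) 0) :=
        TotalSpace.ext rfl (heq_of_eq (hvel 0 h00))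
      rw [h1, hβl0]
      refine TotalSpace.ext ?_ ?_
      · show θ (r, θ (-r, γ t)) = γ t
        exact flow_apply_flow_neg hθ0 hθadd r (γ t)
      · show HEq (mfderiv (𝓡 4) (𝓡 4) (fun q ↦ θ (r, q)) (θ (-r, γ t)) k) v
        exact heq_of_eq hkv
    exact isMaximalGeodesicOn_add_mem_of_isGeodesicOn hγ ht (div_pos hε hl) hβ' hlift hu'
  -- the quantitative escape law at the two ends
  have hwpos : ∀ t ∈ s, 0 < w t := fun t ht ↦ (key t ht).1
  have hup : BddAbove s → ∀ t ∈ s, ε ^ 2 / (sSup s - t) ^ 2 ≤ w t := by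
    intro hab t ht
    obtain ⟨hw0, hI⟩ := key t ht
    have hl : 0 < Real.sqrt (w t) := Real.sqrt_pos.2 hw0
    have h1 := le_csSup_sub_of_forall_add_mem hab (div_pos hε hl) hI
    have h2 := sq_div_sq_le_of_div_le hε hl h1
    rwa [Real.sq_sqrt hw0.le] at h2
  have hdown : BddBelow s → ∀ t ∈ s, ε ^ 2 / (t - sInf s) ^ 2 ≤ w t := by
    intro hbb t ht
    obtain ⟨hw0, hI⟩ := key t ht
    have hl : 0 < Real.sqrt (w t) := Real.sqrt_pos.2 hw0
    have h1 := le_sub_csInf_of_forall_add_mem hbb (div_pos hε hl) hI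
    have h2 := sq_div_sq_le_of_div_le hε hl h1
    rwa [Real.sq_sqrt hw0.le] at h2
  -- both ends are infinite (N3), and then convexity on `ℝ` (R1) contradicts boundedness
  obtain ⟨hna, hnb⟩ := stub_logDivergenceAtFiniteEnd φ u w s (ε ^ 2) M hso hsc ⟨t₀, ht₀⟩ (by positivity)
    hφ' hu' hMφ hup hdown
  have hsu : s = univ := eq_univ_of_not_bddAbove_of_not_bddBelow hsc hna hnb
  obtain ⟨t, hMt⟩ := stub_convexBoundedLine φ u w (fun t ↦ hφ' t (hsu ▸ mem_univ t))
    (fun t ↦ hu' t (hsu ▸ mem_univ t)) (fun t ↦ hwpos t (hsu ▸ mem_univ t)) M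
  have := hMφ t (hsu ▸ mem_univ t)
  linarith


/-! ### The crux from ZF₀ alone -/

/-- **`ErgoregionBombModT ⇐ ZF₀` — unconditionally.**  If every telescope hole carries, for every compact subset `S` of
its d.o.c., an open `W ⊇ ⋃ₜ φₜ(S)` and a flow-invariant `F ∈ C²(W)` strictly convex along the non-zero zero-energy null
vectors over `S` (hypothesis `hZF`, the registered open stub `stub_zeroEnergyNullConvexFunction` of line `SketchIdeator4`
verbatim), then the crux `Theses.ZeroEnergyKerrOrBomb.ErgoregionBombModT` holds — the conclusion below is its body verbatim,
so that the type δ-unfolds to the route decl while the file stays free of the `Theses` import.  Proof: the crux's antecedent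
(a maximal null geodesic with `γ̇ ≠ 0`, `g(γ̇, T) = 0` confined to the cage of `S`) is empty by the X-free engine
`stub_escapeEngineFree`.  Supersedes the conditional `ergoregionBombModT_of_nullConvex` (p160463), whose extra hypothesis —
the named fact `chruscielCosta2008_spacelikeTimeFunction` (Chruściel–Costa 2008, Thm. 4.5) — is not needed. -/
theorem ergoregionBombModT_of_nullConvexFunction
    (hZF : ∀ (𝓑 : Literature.Geometry.Lorentzian.StationaryAFBlackHole.{0}) [𝓑.metric.HasLeviCivita] [Literature.Geometry.Lorentzian.Kerr.Facts], 𝓑.metric.toPseudoRiemannianMetric.IsRicciFlat → 𝓑.IsIPlusRegular → (∀ p : 𝓑.carrier, p ∈ 𝓑.metric.chronologicalFuture 𝓑.timeOrientation 𝓑.Mext) → (∀ p ∈ 𝓑.doc, 𝓑.killing p ≠ 0) → SimplyConnectedSpace 𝓑.doc → ∀ (U : Set 𝓑.carrier) (K : Π x : 𝓑.carrier, TangentSpace (𝓡 4) x), IsOpen U → 𝓑.horizon ⊆ U → IsConnected 𝓑.horizon → ContMDiffOn (𝓡 4) ((𝓡 4).prod 𝓘(ℝ, Literature.Geometry.Lorentzian.E4))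 ((⊤ : ℕ∞) : WithTop ℕ∞) (fun x ↦ (Bundle.TotalSpace.mk' Literature.Geometry.Lorentzian.E4 x (K x) : TangentBundle (𝓡 4) 𝓑.carrier)) U → (∀ x ∈ U, ∀ v w : TangentSpace (𝓡 4) x, 𝓑.metric.val x (𝓑.metric.leviCivita K x v) w + 𝓑.metric.val x v (𝓑.metric.leviCivita K x w) = 0) → (∀ x ∈ U, VectorField.mlieBracket (𝓡 4) 𝓑.killing K x = 0) → (∀ p ∈ 𝓑.horizon, K p ≠ 0) → (∀ γ : ℝ → 𝓑.carrier, IsMIntegralCurve γ K → γ 0 ∈ 𝓑.horizon → ∀ t, γ t ∈ 𝓑.horizon) → (∀ x ∈ U ∩ 𝓑.doc, 𝓑.metric.val x (K x) (K x) < 0) → (∃ S₀ : Set 𝓑.carrier, IsCompact S₀ ∧ S₀ ⊆ 𝓑.doc ∧ ∀ y ∈ 𝓑.doc, 0 ≤ 𝓑.metric.val y (𝓑.killing y) (𝓑.killing y) → y ∉ U → y ∈ Literature.Geometry.Lorentzian.stationaryOrbit 𝓑.killing S₀) → ∀ S : Set 𝓑.carrier, IsCompact S → S ⊆ 𝓑.doc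 → ∃ (W : Set 𝓑.carrier) (F : 𝓑.carrier → ℝ), IsOpen W ∧ Literature.Geometry.Lorentzian.stationaryOrbit 𝓑.killing S ⊆ W ∧ ContMDiffOn (𝓡 4) 𝓘(ℝ, ℝ) 2 F W ∧ (∀ σ : ℝ → 𝓑.carrier, IsMIntegralCurve σ 𝓑.killing → σ 0 ∈ W → ∀ t, F (σ t) = F (σ 0)) ∧ ∀ x ∈ S, ∀ k : TangentSpace (𝓡 4) x, 𝓑.metric.val x k k = 0 → 𝓑.metric.val x k (𝓑.killing x) = 0 → k ≠ 0 → 0 < 𝓑.metric.toPseudoRiemannianMetric.hessian F x k k) :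
    ∀ (𝓑 : Literature.Geometry.Lorentzian.StationaryAFBlackHole.{0}) [𝓑.metric.HasLeviCivita] [Literature.Geometry.Lorentzian.Kerr.Facts], 𝓑.metric.toPseudoRiemannianMetric.IsRicciFlat → 𝓑.IsIPlusRegular → (∀ p : 𝓑.carrier, p ∈ 𝓑.metric.chronologicalFuture 𝓑.timeOrientation 𝓑.Mext) → (∀ p ∈ 𝓑.doc, 𝓑.killing p ≠ 0) → SimplyConnectedSpace 𝓑.doc → ∀ (U : Set 𝓑.carrier) (K : Π x : 𝓑.carrier, TangentSpace (𝓡 4) x), IsOpen U → 𝓑.horizon ⊆ U → IsConnected 𝓑.horizon → ContMDiffOn (𝓡 4) ((𝓡 4).prod 𝓘(ℝ, Literature.Geometry.Lorentzian.E4)) ((⊤ : ℕ∞) : WithTop ℕ∞) (fun x ↦ (Bundle.TotalSpace.mk' Literature.Geometry.Lorentzian.E4 x (K x) : TangentBundle (𝓡 4) 𝓑.carrier)) U → (∀ x ∈ U, ∀ v w : TangentSpace (𝓡 4) x, 𝓑.metric.val x (𝓑.metric.leviCivita K x v) w + 𝓑.metric.val x v (𝓑.metric.leviCivita K x w) = 0)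 → (∀ x ∈ U, VectorField.mlieBracket (𝓡 4) 𝓑.killing K x = 0) → (∀ p ∈ 𝓑.horizon, K p ≠ 0) → (∀ γ : ℝ → 𝓑.carrier, IsMIntegralCurve γ K → γ 0 ∈ 𝓑.horizon → ∀ t, γ t ∈ 𝓑.horizon) → (∀ x ∈ U ∩ 𝓑.doc, 𝓑.metric.val x (K x) (K x) < 0) → (∃ S₀ : Set 𝓑.carrier, IsCompact S₀ ∧ S₀ ⊆ 𝓑.doc ∧ ∀ y ∈ 𝓑.doc, 0 ≤ 𝓑.metric.val y (𝓑.killing y) (𝓑.killing y) → y ∉ U → y ∈ Literature.Geometry.Lorentzian.stationaryOrbit 𝓑.killing S₀) → ∀ S : Set 𝓑.carrier, IsCompact S → S ⊆ 𝓑.doc → ∀ (γ : ℝ → 𝓑.carrier) (s : Set ℝ), Literature.Geometry.Lorentzian.IsMaximalGeodesicOn 𝓑.metric.toPseudoRiemannianMetric.leviCivita γ s → s.Nonempty → (∀ t ∈ s, 𝓑.metric.val (γ t) (Literature.Geometry.Lorentzian.velocity (𝓡 4) γ t) (Literature.Geometry.Lorentzian.velocity (𝓡 4) γ t) = 0 ∧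 Literature.Geometry.Lorentzian.velocity (𝓡 4) γ t ≠ 0 ∧ 𝓑.metric.val (γ t) (Literature.Geometry.Lorentzian.velocity (𝓡 4) γ t) (𝓑.killing (γ t)) = 0) → (∀ t ∈ s, γ t ∈ Literature.Geometry.Lorentzian.stationaryOrbit 𝓑.killing S) → ∃ (ν ω : ℝ) (ψ χ : 𝓑.carrier → ℝ), 0 < ν ∧ (∃ U : Set 𝓑.carrier, IsOpen U ∧ 𝓑.doc ∪ 𝓑.horizon ⊆ U ∧ ContMDiffOn (𝓡 4) 𝓘(ℝ, ℝ) ((⊤ : ℕ∞) : WithTop ℕ∞) ψ U ∧ ContMDiffOn (𝓡 4) 𝓘(ℝ, ℝ) ((⊤ : ℕ∞) : WithTop ℕ∞) χ U) ∧ (∀ x ∈ 𝓑.doc, 𝓑.metric.dalembertian ψ x = 0 ∧ 𝓑.metric.dalembertian χ x = 0) ∧ (∀ x ∈ 𝓑.doc, mfderiv (𝓡 4) 𝓘(ℝ, ℝ) ψ x (𝓑.killing x) = ν * ψ x - ω * χ x ∧ mfderiv (𝓡 4) 𝓘(ℝ, ℝ) χ x (𝓑.killing x) = ω * ψ x + ν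 * χ x) ∧ (∃ C : ℝ, ∀ x ∈ 𝓑.doc ∩ 𝓑.metric.chronologicalPast 𝓑.timeOrientation (𝓑.embed '' 𝓑.e.far (𝓑.e.R + 1)), |ψ x| ≤ C ∧ |χ x| ≤ C) ∧ ∃ x ∈ 𝓑.doc, ψ x ≠ 0 ∨ χ x ≠ 0 := by
  intro 𝓑 _ _ h1 h2 h3 h4 h5 U K hU hHU hc hK hKill hbr hK0 htan htl hbelt S hS hSd γ s hγ hs hz hin
  exfalso
  obtain ⟨W, F, hW, hSW, hF, hinv, hpos⟩ :=
    hZF 𝓑 h1 h2 h3 h4 h5 U K hU hHU hc hK hKill hbr hK0 htan htl hbelt S hS hSd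
  exact stub_escapeEngineFree 𝓑 S W F hS hW hSW hF hinv hpos γ s hγ hs hz hin

end Summit.FinalStateConjecture.FinalStateConjecture.Theorems.ErgoregionBombModT

end
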